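import Mathlib
import HarnessLib
import Summits.QuantumFields.YangMills.Theorems.PencilRigidityShellRigidityTransversePinchGrowth
import Summits.QuantumFields.YangMills.Theorems.PencilRigidityShellRigidityTransversePinchChart
import Summits.QuantumFields.YangMills.Theorems.PencilRigidityShellRigiditySmearedChartIdentity
import Summits.QuantumFields.YangMills.Theorems.PencilRigidityShellRigidityTransverseSmearBound
import Summits.QuantumFields.YangMills.Theorems.PencilRigidityShellRigidityBoxMeanVanish

/-!
# The transverse pinch (registered stub `stub_transversePinch`, crux `PencilRigidity.ShellRigidity`,
line `thales-slit-exact-cone-type`, stmt-QuantumFields-11685)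

Second line lead's back end. Informal statement: let `K : ℝ⁴ → ℝ` be continuous off the origin with
`|K x| ≤ C (1 + ‖x‖^{-a})`, `2 < a < 10`; let `μ ε`, `μ' ε` (`ε > 0`) be finite positive measures on
momentum space carried by the light cone `{p₀ ≥ |p₁|}`; and suppose the AXIS angular traces
`φ ↦ K(t cos φ, t sin φ, y, z)` and the DIAGONAL ones `φ ↦ K(t cos(φ - π/4), t sin(φ - π/4), y, z)` are
trigonometric polynomials `b₀ + b₁ cos 4φ + b₂ cos 8φ` (resp. with `b'`) whose values at the imaginary angle
`iχ` are the chart integrals `∫ exp(-(t ch χ - ε) p₀ - t sh χ p₁ + i(y p₂ + z p₃)) dμ_ε` (resp. `dμ'_ε`) for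
`0 < ε < t e^{-|χ|}` (this is what `stub_angleBandLimit` delivers for `K` and for its 45° rotation). Then
`b₁ = b₂ = 0`: `K(t cos φ, t sin φ, y, z) = K(t, 0, y, z)`.

Proof. Fix `t`. The coefficient functions `ζ ↦ b_j(t, ζ)` are continuous (three transverse traces of
`K`). Smearing the chart identity over a box `Q = [0,δ]²` (`stub_smearedChartIdentity`) gives
`S₀ + S₁ ch 4χ + S₂ ch 8χ = ∫ e^{-(A p₀ + B p₁)} Φ dμ_ε =: I ≥ 0`, `(A,B) = (t ch χ - ε, t sh χ)`,
`ε = t e^{-χ}/2`, `S_j = ∫_Q∫_Q b_j(t, w - w')`. On the cone the weight is `≤ e^{-(s - ε) p₀}`,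
`s = t e^{-χ}`, and the smeared chart integral with that weight is, by the chart identity at time `s`,
`χ = 0`, the smeared kernel `∫_Q∫_Q K(s, 0, w - w') ≤ C'(1 + s^{2-a})` (`stub_transverseSmearBound`:
the two transverse dimensions are gained here). Since `a - 2 < 8`, the growth pinches
(`TransversePinch.top_nonneg/top_nonpos`) give `S₂ = 0` for every box; `stub_boxMeanVanish` gives
`b₂(t,0) = 0`; the two-point positivity `P(0) ± P(ζ) ≥ 0` of the chart integrals
(`TransversePinch.two_point`) and the pinch from below give `|b₂(t,ζ)| ≤ b₂(t,0) = 0`. With the mode 8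
gone, the axis identity gives `S₀ + S₁ ch 4χ ≥ 0` and the diagonal one (`b' = (b₀, -b₁, b₂)` by
uniqueness of trigonometric coefficients) gives `S₀ - S₁ ch 4χ ≥ 0`, so `S₁ = 0`, `b₁(t,0) = 0`,
`|b₁(t,ζ)| ≤ b₁(t,0) = 0`. The threshold is visible: for `a = 10` the witness `H₈(x) r⁻¹⁸` has `S₂ > 0`
and `I(χ) ≍ e^{8χ}` is exactly not pinched.
-/

noncomputable section

namespace Summit.QuantumFields.YangMills.Cruxes.ShellRigidity.ThalesSlitExactConeType

open MeasureTheory Complex Real Filter Topology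
open scoped InnerProductSpace BigOperators

local notation "E4" => EuclideanSpace ℝ (Fin 4)

namespace TransversePinch

/-- Joint continuity of `(w, w') ↦ c (w - w')` (coordinatewise) for a continuous `c`. -/
theorem cont_sub_comp {c : ℝ → ℝ → ℝ} (hc : Continuous fun ζ : ℝ × ℝ => c ζ.1 ζ.2) :
    Continuous (Function.uncurry fun w w' : ℝ × ℝ => c (w.1 - w'.1) (w.2 - w'.2)) :=
  hc.comp (by fun_prop : Continuous fun p : (ℝ × ℝ) × (ℝ × ℝ) => (p.1.1 - p.2.1, p.1.2 - p.2.2))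

/-- Sums of jointly continuous functions, uncurried form. -/
theorem uncurry_add {f g : ℝ × ℝ → ℝ × ℝ → ℝ} (hf : Continuous (Function.uncurry f))
    (hg : Continuous (Function.uncurry g)) :
    Continuous (Function.uncurry fun w w' : ℝ × ℝ => f w w' + g w w') :=
  hf.add hg

/-- Scalar multiples of jointly continuous functions, uncurried form. -/
theorem uncurry_const_mul (c : ℝ) {f : ℝ × ℝ → ℝ × ℝ → ℝ} (hf : Continuous (Function.uncurry f)) :
    Continuous (Function.uncurry fun w w' : ℝ × ℝ => c * f w w') :=
  continuous_const.mul hf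

end TransversePinch

/-! ## The registered stub -/

open TransversePinch in
/-- **Stub B · the transverse pinch.** See the line skeleton `Lines/thales-slit-exact-cone-type.lean` for the
statement's role. Proof: fix `t`; the coefficient functions `ζ ↦ b_j(t,ζ)` are continuous and even; smearing
the chart identity over a box `[0,δ]²` (`stub_smearedChartIdentity`) gives
`S₀ + S₁ ch 4χ + S₂ ch 8χ = ∫ e^{-(A p₀ + B p₁)} Φ dμ_ε ≥ 0` with `(A,B) = (t ch χ - ε, t sh χ)`,
`ε = t e^{-χ}/2`; on the cone the weight is at most `e^{-(s-ε)p₀}`, `s = t e^{-χ}`, whose smeared chart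
integral is the smeared kernel at the real time `s`, bounded by `C'(1 + s^{2-a})` (`stub_transverseSmearBound`);
the growth pinch (`a - 2 < 8`) gives `S₂ = 0` for every box, `stub_boxMeanVanish` gives `b₂(t,0) = 0`, and the
two-point positivity gives `|b₂(t,ζ)| ≤ b₂(t,0)`; then the axis and diagonal data pinch `S₁` and the same two
steps give `b₁ ≡ 0`. -/
theorem stub_transversePinch (K : E4 → ℝ) (C a : ℝ) (ha2 : 2 < a) (ha10 : a < 10)
    (hcont : ContinuousOn K {x : E4 | x ≠ 0})
    (hdecay : ∀ x : E4, x ≠ 0 → |K x| ≤ C * (1 + ‖x‖ ^ (-a)))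
    (μ μ' : ℝ → Measure E4)
    (hfin : ∀ ε : ℝ, 0 < ε → IsFiniteMeasure (μ ε))
    (hfin' : ∀ ε : ℝ, 0 < ε → IsFiniteMeasure (μ' ε))
    (hcone : ∀ ε : ℝ, 0 < ε → μ ε {p : E4 | p 0 < |p 1|} = 0)
    (hcone' : ∀ ε : ℝ, 0 < ε → μ' ε {p : E4 | p 0 < |p 1|} = 0)
    (b b' : Fin 3 → ℝ → ℝ → ℝ → ℝ)
    (hb : ∀ t : ℝ, 0 < t → ∀ y z : ℝ,
      (∀ φ : ℝ, K (WithLp.toLp 2 ![t * Real.cos φ, t * Real.sin φ, y, z]) =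
        b 0 t y z + b 1 t y z * Real.cos (4 * φ) + b 2 t y z * Real.cos (8 * φ)) ∧
      (∀ χ ε : ℝ, 0 < ε → ε < t * Real.exp (-|χ|) →
        (((b 0 t y z + b 1 t y z * Real.cosh (4 * χ) + b 2 t y z * Real.cosh (8 * χ) : ℝ)) : ℂ) =
          ∫ p, Complex.exp ((((-((t * Real.cosh χ - ε) * p 0 + t * Real.sinh χ * p 1)) : ℝ) : ℂ) +
            ((y * p 2 + z * p 3 : ℝ) : ℂ) * Complex.I) ∂(μ ε)))
    (hb' : ∀ t : ℝ, 0 < t → ∀ y z : ℝ,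
      (∀ φ : ℝ, K (WithLp.toLp 2 ![t * Real.cos (φ - π / 4), t * Real.sin (φ - π / 4), y, z]) =
        b' 0 t y z + b' 1 t y z * Real.cos (4 * φ) + b' 2 t y z * Real.cos (8 * φ)) ∧
      (∀ χ ε : ℝ, 0 < ε → ε < t * Real.exp (-|χ|) →
        (((b' 0 t y z + b' 1 t y z * Real.cosh (4 * χ) + b' 2 t y z * Real.cosh (8 * χ) : ℝ)) : ℂ) =
          ∫ p, Complex.exp ((((-((t * Real.cosh χ - ε) * p 0 + t * Real.sinh χ * p 1)) : ℝ) : ℂ) +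
            ((y * p 2 + z * p 3 : ℝ) : ℂ) * Complex.I) ∂(μ' ε))) :
    ∀ t : ℝ, 0 < t → ∀ y z φ : ℝ,
      K (WithLp.toLp 2 ![t * Real.cos φ, t * Real.sin φ, y, z]) = K (WithLp.toLp 2 ![t, 0, y, z]) := by
  ------------------------------------------------------------------
  -- Reduction: it suffices that the modes 4 and 8 vanish.
  ------------------------------------------------------------------
  suffices hvan : ∀ t : ℝ, 0 < t → ∀ y z : ℝ, b 1 t y z = 0 ∧ b 2 t y z = 0 by
    intro t ht y z φ
    obtain ⟨h1, h2⟩ := hvan t ht y z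
    rw [(hb t ht y z).1 φ]
    have e0 := (hb t ht y z).1 0
    simp only [mul_zero, Real.cos_zero, Real.sin_zero, mul_one] at e0
    rw [e0, h1, h2]; ring
  ------------------------------------------------------------------
  -- Common tools at a fixed time `t`.
  ------------------------------------------------------------------
  -- the side condition of the chart identity at `χ ≥ 0` with `ε = t e^{-χ}/2`
  have eps_ok : ∀ t : ℝ, 0 < t → ∀ χ : ℝ, 0 ≤ χ →
      0 < t * Real.exp (-χ) / 2 ∧ t * Real.exp (-χ) / 2 < t * Real.exp (-|χ|) := by
    intro t ht χ hχ
    rw [abs_of_nonneg hχ]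
    have := Real.exp_pos (-χ)
    constructor
    · positivity
    · nlinarith
  -- `|t sh χ| < t ch χ - ε` for `ε < t e^{-χ}`, `χ ≥ 0`
  have AB_ok : ∀ t : ℝ, 0 < t → ∀ χ : ℝ, 0 ≤ χ → ∀ ε : ℝ, ε < t * Real.exp (-|χ|) →
      |t * Real.sinh χ| < t * Real.cosh χ - ε := by
    intro t ht χ hχ ε hε
    rw [abs_of_nonneg hχ] at hε
    rw [abs_of_nonneg (mul_nonneg ht.le (Real.sinh_nonneg_iff.2 hχ))]
    have := Real.cosh_sub_sinh χ
    nlinarith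
  -- continuity and evenness of the coefficient functions of `b` and `b'`
  have cont_b : ∀ t : ℝ, 0 < t → ∀ j : Fin 3, Continuous fun ζ : ℝ × ℝ => b j t ζ.1 ζ.2 := by
    intro t ht
    obtain ⟨h0, h1, h2⟩ := coeff_continuous hcont (θ := 0) ht.ne' (c₀ := fun ζ => b 0 t ζ.1 ζ.2)
      (c₁ := fun ζ => b 1 t ζ.1 ζ.2) (c₂ := fun ζ => b 2 t ζ.1 ζ.2)
      (fun ζ φ => by simpa using (hb t ht ζ.1 ζ.2).1 φ)
    intro j; fin_cases j
    exacts [h0, h1, h2]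
  have cont_b' : ∀ t : ℝ, 0 < t → ∀ j : Fin 3, Continuous fun ζ : ℝ × ℝ => b' j t ζ.1 ζ.2 := by
    intro t ht
    obtain ⟨h0, h1, h2⟩ := coeff_continuous hcont (θ := π / 4) ht.ne' (c₀ := fun ζ => b' 0 t ζ.1 ζ.2)
      (c₁ := fun ζ => b' 1 t ζ.1 ζ.2) (c₂ := fun ζ => b' 2 t ζ.1 ζ.2)
      (fun ζ φ => (hb' t ht ζ.1 ζ.2).1 φ)
    intro j; fin_cases j
    exacts [h0, h1, h2]
  -- the relation between the diagonal and the axis coefficients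
  have rel : ∀ t : ℝ, 0 < t → ∀ y z : ℝ,
      b' 0 t y z = b 0 t y z ∧ b' 1 t y z = -b 1 t y z ∧ b' 2 t y z = b 2 t y z := by
    intro t ht y z
    have key : ∀ φ : ℝ, b' 0 t y z + b' 1 t y z * Real.cos (4 * φ) + b' 2 t y z * Real.cos (8 * φ) =
        b 0 t y z + (-b 1 t y z) * Real.cos (4 * φ) + b 2 t y z * Real.cos (8 * φ) := by
      intro φ
      rw [← (hb' t ht y z).1 φ, (hb t ht y z).1 (φ - π / 4)]
      rw [show 4 * (φ - π / 4) = 4 * φ - π by ring, show 8 * (φ - π / 4) = 8 * φ - 2 * π by ring,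
        Real.cos_sub_pi, Real.cos_sub_two_pi]
      ring
    exact trig_unique key
  ------------------------------------------------------------------
  -- The smeared chart identity and its two bounds, for a family `ν` (`= μ` or `μ'`) and table `d` (`= b` or `b'`).
  ------------------------------------------------------------------
  have smear : ∀ (ν : ℝ → Measure E4) (d : Fin 3 → ℝ → ℝ → ℝ → ℝ),
      (∀ ε : ℝ, 0 < ε → IsFiniteMeasure (ν ε)) →
      (∀ ε : ℝ, 0 < ε → ν ε {p : E4 | p 0 < |p 1|} = 0) →
      ∀ t : ℝ, 0 < t →
      (∀ j : Fin 3, Continuous fun ζ : ℝ × ℝ => d j t ζ.1 ζ.2) →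
      (∀ t' : ℝ, 0 < t' → ∀ y z : ℝ, ∀ χ ε : ℝ, 0 < ε → ε < t' * Real.exp (-|χ|) →
        (((d 0 t' y z + d 1 t' y z * Real.cosh (4 * χ) + d 2 t' y z * Real.cosh (8 * χ) : ℝ)) : ℂ) =
          ∫ p, Complex.exp ((((-((t' * Real.cosh χ - ε) * p 0 + t' * Real.sinh χ * p 1)) : ℝ) : ℂ) +
            ((y * p 2 + z * p 3 : ℝ) : ℂ) * Complex.I) ∂(ν ε)) →
      ∀ δ : ℝ, 0 < δ → ∀ χ : ℝ, 0 ≤ χ →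
        ∃ I : ℝ, 0 ≤ I ∧
          (∫ w in Set.Icc (0 : ℝ) δ ×ˢ Set.Icc (0 : ℝ) δ, ∫ w' in Set.Icc (0 : ℝ) δ ×ˢ Set.Icc (0 : ℝ) δ,
              d 0 t (w.1 - w'.1) (w.2 - w'.2)) +
            (∫ w in Set.Icc (0 : ℝ) δ ×ˢ Set.Icc (0 : ℝ) δ, ∫ w' in Set.Icc (0 : ℝ) δ ×ˢ Set.Icc (0 : ℝ) δ,
              d 1 t (w.1 - w'.1) (w.2 - w'.2)) * Real.cosh (4 * χ) +
            (∫ w in Set.Icc (0 : ℝ) δ ×ˢ Set.Icc (0 : ℝ) δ, ∫ w' in Set.Icc (0 : ℝ) δ ×ˢ Set.Icc (0 : ℝ) δ,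
              d 2 t (w.1 - w'.1) (w.2 - w'.2)) * Real.cosh (8 * χ) = I ∧
          -- the pinch from above: `I` is at most the smeared chart integral at time `s = t e^{-χ}`, `χ = 0`
          I ≤ ∫ w in Set.Icc (0 : ℝ) δ ×ˢ Set.Icc (0 : ℝ) δ, ∫ w' in Set.Icc (0 : ℝ) δ ×ˢ Set.Icc (0 : ℝ) δ,
              (d 0 (t * Real.exp (-χ)) (w.1 - w'.1) (w.2 - w'.2) +
                d 1 (t * Real.exp (-χ)) (w.1 - w'.1) (w.2 - w'.2) +
                d 2 (t * Real.exp (-χ)) (w.1 - w'.1) (w.2 - w'.2)) := by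
    intro ν d νfin νcone t ht dcont drep δ hδ χ hχ
    obtain ⟨hε, hεt⟩ := eps_ok t ht χ hχ
    set ε : ℝ := t * Real.exp (-χ) / 2 with hε_def
    set s : ℝ := t * Real.exp (-χ) with hs_def
    have hs : 0 < s := by positivity
    haveI := νfin ε hε
    obtain ⟨Φ, hΦm, hΦ0, ⟨M, hΦM⟩, hΦ⟩ := stub_smearedChartIdentity (ν ε) (νcone ε hε) δ hδ
    -- the two weights
    have hAB : |t * Real.sinh χ| < t * Real.cosh χ - ε := AB_ok t ht χ hχ ε hεt
    have hεs : ε < s * Real.exp (-|(0:ℝ)|) := by simp [hε_def, hs_def]; nlinarith [Real.exp_pos (-χ)]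
    have hAB' : |s * Real.sinh 0| < s * Real.cosh 0 - ε := by
      simp only [Real.sinh_zero, mul_zero, abs_zero, Real.cosh_zero, mul_one]
      simp [hε_def, hs_def]; nlinarith [Real.exp_pos (-χ)]
    obtain ⟨hint, hid⟩ := hΦ _ _ hAB
    obtain ⟨hint', hid'⟩ := hΦ _ _ hAB'
    refine ⟨∫ p, Real.exp (-((t * Real.cosh χ - ε) * p 0 + t * Real.sinh χ * p 1)) * Φ p ∂(ν ε),
      integral_nonneg fun p => mul_nonneg (Real.exp_pos _).le (hΦ0 p), ?_, ?_⟩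
    · -- the identity: rewrite the inner complex integral through the chart identity, then split
      rw [← hid]
      have hre : ∀ w w' : ℝ × ℝ,
          (∫ p, Complex.exp ((((-((t * Real.cosh χ - ε) * p 0 + t * Real.sinh χ * p 1)) : ℝ) : ℂ) +
            (((w.1 - w'.1) * p 2 + (w.2 - w'.2) * p 3 : ℝ) : ℂ) * Complex.I) ∂(ν ε)).re =
          d 0 t (w.1 - w'.1) (w.2 - w'.2) + Real.cosh (4 * χ) * d 1 t (w.1 - w'.1) (w.2 - w'.2) +
            Real.cosh (8 * χ) * d 2 t (w.1 - w'.1) (w.2 - w'.2) := by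
        intro w w'
        rw [← drep t ht _ _ χ ε hε hεt, Complex.ofReal_re]; ring
      simp_rw [hre]
      rw [iter_add (uncurry_add (cont_sub_comp (dcont 0)) (uncurry_const_mul _ (cont_sub_comp (dcont 1))))
        (uncurry_const_mul _ (cont_sub_comp (dcont 2))) δ,
        iter_add (cont_sub_comp (dcont 0)) (uncurry_const_mul _ (cont_sub_comp (dcont 1))) δ,
        iter_const_mul, iter_const_mul]
      ring
    · -- the bound: monotonicity of the weight on the cone, then the chart identity at time `s`, `χ = 0`
      calc ∫ p, Real.exp (-((t * Real.cosh χ - ε) * p 0 + t * Real.sinh χ * p 1)) * Φ p ∂(ν ε)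
          ≤ ∫ p, Real.exp (-((s * Real.cosh 0 - ε) * p 0 + s * Real.sinh 0 * p 1)) * Φ p ∂(ν ε) := by
            refine integral_mono_ae hint hint' ?_
            have hw := ae_weight_mono (νcone ε hε) (A := t * Real.cosh χ - ε) (B := t * Real.sinh χ)
              (A' := s * Real.cosh 0 - ε) (B' := s * Real.sinh 0) (by
                simp only [Real.sinh_zero, mul_zero, abs_zero, add_zero, Real.cosh_zero, mul_one]
                rw [abs_of_nonneg (mul_nonneg ht.le (Real.sinh_nonneg_iff.2 hχ)), hs_def]
                have := Real.cosh_sub_sinh χ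
                nlinarith)
            filter_upwards [hw] with p hp
            exact mul_le_mul_of_nonneg_right hp (hΦ0 p)
        _ = ∫ w in Set.Icc (0 : ℝ) δ ×ˢ Set.Icc (0 : ℝ) δ, ∫ w' in Set.Icc (0 : ℝ) δ ×ˢ Set.Icc (0 : ℝ) δ,
              (d 0 s (w.1 - w'.1) (w.2 - w'.2) + d 1 s (w.1 - w'.1) (w.2 - w'.2) +
                d 2 s (w.1 - w'.1) (w.2 - w'.2)) := by
            rw [← hid']
            refine integral_congr_ae (ae_of_all _ fun w => integral_congr_ae (ae_of_all _ fun w' => ?_))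
            have := drep s hs (w.1 - w'.1) (w.2 - w'.2) 0 ε hε hεs
            beta_reduce
            simp only [mul_zero, Real.cosh_zero, Real.sinh_zero, mul_one, zero_mul, add_zero] at this ⊢
            rw [← this, Complex.ofReal_re]
  ------------------------------------------------------------------
  -- Step 1: the mode 8 vanishes.
  ------------------------------------------------------------------
  have step1 : ∀ t : ℝ, 0 < t → ∀ y z : ℝ, b 2 t y z = 0 := by
    intro t ht
    -- (a) every box smearing of `b 2 t` vanishes
    have hS2 : ∀ δ : ℝ, 0 < δ →
        ∫ w in Set.Icc (0 : ℝ) δ ×ˢ Set.Icc (0 : ℝ) δ, ∫ w' in Set.Icc (0 : ℝ) δ ×ˢ Set.Icc (0 : ℝ) δ,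
          b 2 t (w.1 - w'.1) (w.2 - w'.2) = 0 := by
      intro δ hδ
      obtain ⟨C', hC'⟩ := stub_transverseSmearBound K C a ha2 hcont hdecay δ hδ
      set S : Fin 3 → ℝ := fun j => ∫ w in Set.Icc (0 : ℝ) δ ×ˢ Set.Icc (0 : ℝ) δ,
        ∫ w' in Set.Icc (0 : ℝ) δ ×ˢ Set.Icc (0 : ℝ) δ, b j t (w.1 - w'.1) (w.2 - w'.2) with hS_def
      have hlow : ∀ χ : ℝ, 0 ≤ χ → 0 ≤ S 0 + S 1 * Real.cosh (4 * χ) + S 2 * Real.cosh (8 * χ) := by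
        intro χ hχ
        obtain ⟨I, hI0, hI, -⟩ := smear μ b hfin hcone t ht (cont_b t ht)
          (fun t' ht' y z χ ε hε hεt => (hb t' ht' y z).2 χ ε hε hεt) δ hδ χ hχ
        simp only [hS_def]
        linarith
      have hup : ∀ χ : ℝ, 0 ≤ χ → S 0 + S 1 * Real.cosh (4 * χ) + S 2 * Real.cosh (8 * χ) ≤
          |C'| * (1 + t ^ (2 - a)) * (1 + Real.exp ((a - 2) * χ)) := by
        intro χ hχ
        obtain ⟨I, -, hI, hIle⟩ := smear μ b hfin hcone t ht (cont_b t ht)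
          (fun t' ht' y z χ ε hε hεt => (hb t' ht' y z).2 χ ε hε hεt) δ hδ χ hχ
        set s : ℝ := t * Real.exp (-χ) with hs_def
        have hs : 0 < s := by positivity
        -- the smeared chart integral at time `s`, `χ = 0`, is the smeared kernel
        have hK : ∫ w in Set.Icc (0 : ℝ) δ ×ˢ Set.Icc (0 : ℝ) δ, ∫ w' in Set.Icc (0 : ℝ) δ ×ˢ Set.Icc (0 : ℝ) δ,
              (b 0 s (w.1 - w'.1) (w.2 - w'.2) + b 1 s (w.1 - w'.1) (w.2 - w'.2) +
                b 2 s (w.1 - w'.1) (w.2 - w'.2)) =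
            ∫ w in Set.Icc (0 : ℝ) δ ×ˢ Set.Icc (0 : ℝ) δ, ∫ w' in Set.Icc (0 : ℝ) δ ×ˢ Set.Icc (0 : ℝ) δ,
              K (WithLp.toLp 2 ![s, 0, w.1 - w'.1, w.2 - w'.2]) := by
          refine integral_congr_ae (ae_of_all _ fun w => integral_congr_ae (ae_of_all _ fun w' => ?_))
          have := (hb s hs (w.1 - w'.1) (w.2 - w'.2)).1 0
          simp only [mul_zero, Real.cos_zero, Real.sin_zero, mul_one] at this
          beta_reduce
          rw [this]
        have hsa : s ^ (2 - a) = t ^ (2 - a) * Real.exp ((a - 2) * χ) := by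
          rw [hs_def, Real.mul_rpow ht.le (Real.exp_pos _).le, ← Real.exp_mul]
          ring_nf
        have hb1 := hC' s hs
        have ht2 : 0 < t ^ (2 - a) := Real.rpow_pos_of_pos ht _
        have hE : 0 < Real.exp ((a - 2) * χ) := Real.exp_pos _
        calc S 0 + S 1 * Real.cosh (4 * χ) + S 2 * Real.cosh (8 * χ) = I := by simp only [hS_def]; linarith
          _ ≤ C' * (1 + s ^ (2 - a)) := hIle.trans (hK ▸ hb1)
          _ ≤ |C'| * (1 + s ^ (2 - a)) := by
            have : 0 ≤ 1 + s ^ (2 - a) := by positivity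
            exact mul_le_mul_of_nonneg_right (le_abs_self _) this
          _ ≤ |C'| * (1 + t ^ (2 - a)) * (1 + Real.exp ((a - 2) * χ)) := by
            rw [hsa, mul_assoc]
            refine mul_le_mul_of_nonneg_left ?_ (abs_nonneg _)
            nlinarith
      have h1 := top_nonneg hlow
      have h2 := top_nonpos (by linarith : a - 2 < 8) hup
      have : S 2 = 0 := le_antisymm h2 h1
      simpa [hS_def] using this
    -- (b) the value at the origin vanishes
    have h00 : b 2 t 0 0 = 0 := by
      have := stub_boxMeanVanish (fun ζ : ℝ × ℝ => b 2 t ζ.1 ζ.2) (cont_b t ht 2)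
        (fun δ hδ _ => hS2 δ hδ)
      simpa using this
    -- (c) two-point positivity: `|b 2 t y z| ≤ b 2 t 0 0`
    intro y z
    have key : 0 ≤ b 2 t 0 0 + b 2 t y z ∧ 0 ≤ b 2 t 0 0 - b 2 t y z := by
      have tp : ∀ χ : ℝ, 0 ≤ χ →
          0 ≤ (b 0 t 0 0 + b 0 t y z) + (b 1 t 0 0 + b 1 t y z) * Real.cosh (4 * χ) +
              (b 2 t 0 0 + b 2 t y z) * Real.cosh (8 * χ) ∧
          0 ≤ (b 0 t 0 0 - b 0 t y z) + (b 1 t 0 0 - b 1 t y z) * Real.cosh (4 * χ) +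
              (b 2 t 0 0 - b 2 t y z) * Real.cosh (8 * χ) := by
        intro χ hχ
        obtain ⟨hε, hεt⟩ := eps_ok t ht χ hχ
        haveI := hfin _ hε
        obtain ⟨hp, hm⟩ := two_point (hcone _ hε) (AB_ok t ht χ hχ _ hεt).le y z
          ((hb t ht 0 0).2 χ _ hε hεt) ((hb t ht y z).2 χ _ hε hεt)
        constructor <;> linarith
      exact ⟨top_nonneg fun χ hχ => (tp χ hχ).1, top_nonneg fun χ hχ => (tp χ hχ).2⟩
    linarith [key.1, key.2]
  ------------------------------------------------------------------
  -- Step 2: the mode 4 vanishes.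
  ------------------------------------------------------------------
  have step1' : ∀ t : ℝ, 0 < t → ∀ y z : ℝ, b' 2 t y z = 0 := fun t ht y z => by
    rw [(rel t ht y z).2.2]; exact step1 t ht y z
  have step2 : ∀ t : ℝ, 0 < t → ∀ y z : ℝ, b 1 t y z = 0 := by
    intro t ht
    -- (a) every box smearing of `b 1 t` vanishes
    have hS1 : ∀ δ : ℝ, 0 < δ →
        ∫ w in Set.Icc (0 : ℝ) δ ×ˢ Set.Icc (0 : ℝ) δ, ∫ w' in Set.Icc (0 : ℝ) δ ×ˢ Set.Icc (0 : ℝ) δ,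
          b 1 t (w.1 - w'.1) (w.2 - w'.2) = 0 := by
      intro δ hδ
      set S0 : ℝ := ∫ w in Set.Icc (0 : ℝ) δ ×ˢ Set.Icc (0 : ℝ) δ,
        ∫ w' in Set.Icc (0 : ℝ) δ ×ˢ Set.Icc (0 : ℝ) δ, b 0 t (w.1 - w'.1) (w.2 - w'.2) with hS0_def
      set S1 : ℝ := ∫ w in Set.Icc (0 : ℝ) δ ×ˢ Set.Icc (0 : ℝ) δ,
        ∫ w' in Set.Icc (0 : ℝ) δ ×ˢ Set.Icc (0 : ℝ) δ, b 1 t (w.1 - w'.1) (w.2 - w'.2) with hS1_def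
      have hz : ∫ w in Set.Icc (0 : ℝ) δ ×ˢ Set.Icc (0 : ℝ) δ,
          ∫ w' in Set.Icc (0 : ℝ) δ ×ˢ Set.Icc (0 : ℝ) δ, b 2 t (w.1 - w'.1) (w.2 - w'.2) = 0 := by
        simp [step1 t ht]
      have hz' : ∫ w in Set.Icc (0 : ℝ) δ ×ˢ Set.Icc (0 : ℝ) δ,
          ∫ w' in Set.Icc (0 : ℝ) δ ×ˢ Set.Icc (0 : ℝ) δ, b' 2 t (w.1 - w'.1) (w.2 - w'.2) = 0 := by
        simp [step1' t ht]
      have hS0' : ∫ w in Set.Icc (0 : ℝ) δ ×ˢ Set.Icc (0 : ℝ) δ,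
          ∫ w' in Set.Icc (0 : ℝ) δ ×ˢ Set.Icc (0 : ℝ) δ, b' 0 t (w.1 - w'.1) (w.2 - w'.2) = S0 := by
        simp only [hS0_def, fun y z => (rel t ht y z).1]
      have hS1' : ∫ w in Set.Icc (0 : ℝ) δ ×ˢ Set.Icc (0 : ℝ) δ,
          ∫ w' in Set.Icc (0 : ℝ) δ ×ˢ Set.Icc (0 : ℝ) δ, b' 1 t (w.1 - w'.1) (w.2 - w'.2) = -S1 := by
        simp only [hS1_def, fun y z => (rel t ht y z).2.1, integral_neg]
      have hpm : ∀ χ : ℝ, 0 ≤ χ → |S1| * Real.cosh (4 * χ) ≤ S0 := by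
        intro χ hχ
        obtain ⟨I, hI0, hI, -⟩ := smear μ b hfin hcone t ht (cont_b t ht)
          (fun t' ht' y z χ ε hε hεt => (hb t' ht' y z).2 χ ε hε hεt) δ hδ χ hχ
        obtain ⟨I', hI0', hI', -⟩ := smear μ' b' hfin' hcone' t ht (cont_b' t ht)
          (fun t' ht' y z χ ε hε hεt => (hb' t' ht' y z).2 χ ε hε hεt) δ hδ χ hχ
        rw [hz] at hI
        rw [hz', hS0', hS1'] at hI'
        have hp : 0 ≤ S0 + S1 * Real.cosh (4 * χ) := by linarith
        have hm : 0 ≤ S0 - S1 * Real.cosh (4 * χ) := by linarith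
        rcases le_or_gt 0 S1 with h | h
        · rw [abs_of_nonneg h]; linarith
        · rw [abs_of_neg h]; linarith
      exact mid_eq_zero hpm
    -- (b) origin value
    have h00 : b 1 t 0 0 = 0 := by
      have := stub_boxMeanVanish (fun ζ : ℝ × ℝ => b 1 t ζ.1 ζ.2) (cont_b t ht 1)
        (fun δ hδ _ => hS1 δ hδ)
      simpa using this
    -- (c) two-point positivity with the mode 8 gone
    intro y z
    have key : 0 ≤ b 1 t 0 0 + b 1 t y z ∧ 0 ≤ b 1 t 0 0 - b 1 t y z := by
      have tp : ∀ χ : ℝ, 0 ≤ χ →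
          0 ≤ (b 0 t 0 0 + b 0 t y z) + (b 1 t 0 0 + b 1 t y z) * Real.cosh (4 * χ) ∧
          0 ≤ (b 0 t 0 0 - b 0 t y z) + (b 1 t 0 0 - b 1 t y z) * Real.cosh (4 * χ) := by
        intro χ hχ
        obtain ⟨hε, hεt⟩ := eps_ok t ht χ hχ
        haveI := hfin _ hε
        obtain ⟨hp, hm⟩ := two_point (hcone _ hε) (AB_ok t ht χ hχ _ hεt).le y z
          ((hb t ht 0 0).2 χ _ hε hεt) ((hb t ht y z).2 χ _ hε hεt)
        rw [step1 t ht 0 0, step1 t ht y z] at hp hm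
        constructor <;> linarith
      exact ⟨mid_nonneg fun χ hχ => (tp χ hχ).1, mid_nonneg fun χ hχ => (tp χ hχ).2⟩
    linarith [key.1, key.2]
  exact fun t ht y z => ⟨step2 t ht y z, step1 t ht y z⟩

end Summit.QuantumFields.YangMills.Cruxes.ShellRigidity.ThalesSlitExactConeType
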